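import Summits.ResolutionOfSingularities.ResolutionOfSingularities.Theorems.MarkedTransferCampaignW46MohWindowSurfaceTransform
import Mathlib.Algebra.CharP.Lemmas
import HarnessLib

/-!
# [OURS · L1 W4.6 rung (iii-2), HEAVY-ROOT SIDE] Surface Moh window — TRANSFER OF THE RESIDUE FORM between two presentations of
# the same window ideal, and the swapped presentation (cell res-hironaka, LADDER-RESOLUTION rung L, D-0089; seat res-L1-s46-pv-5
# gen 4; host MarkedTransfer, `--supports stmt-ResolutionOfSingularities-16155 --as helper`; statement file `…CampaignW46MohWindowSurface.lean`)

HONEST FRAMING. Nothing here is a statement of H. Hironaka's manuscript [Hironaka2017] and nothing here asserts that any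
statement of it holds. PURE COMMUTATIVE ALGEBRA over a regular local ring of embedding dimension `3` and characteristic `p`, in the
frame of res-D-pv-008 AS res-L1-s46-pv-14's `…MohWindowSurfaceResidualOrder.lean` (quasi-regularity of the regular system of
parameters: `coeff_mem_of_eval_mem_pow_succ`, `mem_pow_succ_of_mul_pow_mem`). AI-written; AI review is weaker than expert review.
No `sorry`; axioms standard.

THE POINT. The heavy-root side of rung (iii-2) reads, at a point `ξ′` of the blow-up, the structure of the transform `J′ = (w^p + h)`
in the CHART coordinates, while the regime `Regime.mohWindowSurface` hands the prover an ARBITRARY coefficient window presentation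
`J′ = (z^p + Σ_{k ≤ d} a_k x^{d−k} y^k)` at the same point; every further step (the `p = 2` cube dynamics, res-L1-s46-pv-5 NOTES
«p = 2 programme», or any secondary invariant) must TRANSFER information between the two. `coeff_sub_mul_coeff_mem_of_span_eq`: if
`(w^p + h) = (z^p + Σ a_k x^{d−k} y^k)` with `w ∈ 𝔪`, `p < d < 2p`, and `h ≡ H(x, y, z) (mod 𝔪^{d+1})` for a form `H` of degree `d`
written in the presentation's parameters, then for a UNIT `u`: `a_k ≡ u · [X^{d−k} Y^k] H (mod 𝔪)` for all `k ≤ d` — the residue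
binary form of the presentation is `ū` times the `Z`-free part of `H̄`. With it: `w = αx + βy + λz` with `α, β ∈ 𝔪`, `λ` a unit
(`eq_lin_comb_of_span_eq`: the tangent plane `Z = 0` is intrinsic). Proof: Frobenius `w^p = α^p x^p + β^p y^p + λ^p z^p`; the
degree-`p` step of quasi-regularity gives `α, β ∈ 𝔪` and `uλ^p ≡ 1`; pushing `(uλ^p − 1) z^p ∈ 𝔪^d` down gives
`uλ^p − 1 = G(x,y,z)` for a form `G` of degree `d − p`; quasi-regularity of the degree-`d` form `F − u·H − G·Z^p` at the `Z`-free
monomials. Also the SWAPPED presentation `coeffForm_swap` (`Σ a_k x^{d−k} y^k = Σ a_{d−k} y^{d−k} x^k`: the root «at infinity» of the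
`x`-chart reading is the root `0` of the `y`-chart reading), so that one-chart statements (e.g. `…Freeze.lean`) cover both charts.
[ZariskiSamuel1960] [Matsumura1987] [HauserWagner2014]
-/

noncomputable section

set_option linter.dupNamespace false -- mandated namespace of this single-conjunct summit

namespace Summit.ResolutionOfSingularities.ResolutionOfSingularities.Theorems.CampaignW46.MohWindowSurface

open IsLocalRing MvPolynomial
open Literature.AlgebraicGeometry.Resolution
open Summit.ResolutionOfSingularities.ResolutionOfSingularities.Theorems.CampaignW46.MohWindowSurfaceResidualOrder

universe u

variable {R : Type u} [CommRing R]

/-! ## 1. The swapped presentation -/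

/-- **The swapped coefficient presentation**: `Σ_{k ≤ d} a_k x^{d−k} y^k = Σ_{k ≤ d} a_{d−k} y^{d−k} x^k` — the same window germ read
with the roles of `x` and `y` exchanged and the coefficient sequence reversed (its `y`-chart residue polynomial is the reversal of
the `x`-chart one). [folklore] -/
theorem coeffForm_swap (x y : R) (d : ℕ) (a : ℕ → R) :
    ∑ k ∈ Finset.range (d + 1), a k * x ^ (d - k) * y ^ k = ∑ k ∈ Finset.range (d + 1), a (d - k) * y ^ (d - k) * x ^ k := by
  have h := Finset.sum_range_reflect (fun k => a k * x ^ (d - k) * y ^ k) (d + 1)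
  rw [← h]
  refine Finset.sum_congr rfl fun k hk => ?_
  have hkd : k ≤ d := Nat.lt_succ_iff.mp (Finset.mem_range.mp hk)
  simp only [show d + 1 - 1 - k = d - k from by omega, Nat.sub_sub_self hkd]
  ring

/-! ## 2. The coefficient form as a form in `(X, Y, Z)` -/

section Form

/-- The coefficient form `Σ_{k ≤ d} a_k X^{d−k} Y^k`, as a polynomial in `(X, Y, Z)`, is homogeneous of degree `d`. [folklore] -/
theorem isHomogeneous_xyForm (d : ℕ) (a : ℕ → R) :
    (∑ k ∈ Finset.range (d + 1), monomial (Finsupp.single 0 (d - k) + Finsupp.single 1 k) (a k) :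
      MvPolynomial (Fin 3) R).IsHomogeneous d := by
  refine IsHomogeneous.sum _ _ _ fun k hk => isHomogeneous_monomial _ ?_
  have hkd : k ≤ d := Nat.lt_succ_iff.mp (Finset.mem_range.mp hk)
  simp only [map_add, Finsupp.degree_single]; omega

/-- It evaluates at `(x, y, z)` to the coefficient form `Σ a_k x^{d−k} y^k`. [folklore] -/
theorem eval_xyForm (x y z : R) (d : ℕ) (a : ℕ → R) :
    eval ![x, y, z] (∑ k ∈ Finset.range (d + 1), monomial (Finsupp.single 0 (d - k) + Finsupp.single 1 k) (a k) :
      MvPolynomial (Fin 3) R) = ∑ k ∈ Finset.range (d + 1), a k * x ^ (d - k) * y ^ k := by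
  rw [map_sum]
  refine Finset.sum_congr rfl fun k _ => ?_
  have hmono : (monomial (Finsupp.single 0 (d - k) + Finsupp.single 1 k) (a k) : MvPolynomial (Fin 3) R) =
      C (a k) * (X 0 ^ (d - k) * X 1 ^ k) := by
    rw [X_pow_eq_monomial, X_pow_eq_monomial, monomial_mul, mul_one, C_mul_monomial, mul_one]
  rw [hmono, map_mul, map_mul, map_pow, map_pow, eval_C, eval_X, eval_X]
  simp only [Matrix.cons_val_zero, Matrix.cons_val_one]
  ring

/-- Its coefficient at `X^{d−k} Y^k` is `a_k` (`k ≤ d`). [folklore] -/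
theorem coeff_xyForm {d k : ℕ} (hk : k ≤ d) (a : ℕ → R) :
    (∑ j ∈ Finset.range (d + 1), monomial (Finsupp.single 0 (d - j) + Finsupp.single 1 j) (a j) :
      MvPolynomial (Fin 3) R).coeff (Finsupp.single 0 (d - k) + Finsupp.single 1 k) = a k := by
  classical
  rw [coeff_sum]
  simp only [coeff_monomial]
  rw [Finset.sum_eq_single k]
  · rw [if_pos rfl]
  · intro j _ hj
    rw [if_neg]
    intro h
    apply hj
    have := congrArg (fun f => f 1) h
    simpa [Finsupp.single_apply] using this
  · intro h
    exact absurd (Finset.mem_range.mpr (Nat.lt_succ_of_le hk)) h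

end Form

/-! ## 3. Transfer of the residue form -/

section Transfer

variable [IsLocalRing R] (p : ℕ) [Fact p.Prime] [CharP R p]

/-- **[OURS · L1 W4.6 rung (iii-2), heavy side] The tangent plane is intrinsic.** If `(w^p + h) = (z^p + f)` as ideals of a
regular local ring of embedding dimension `3` and characteristic `p`, with regular system of parameters `(x, y, z)`, `w ∈ 𝔪` and
`h, f ∈ 𝔪^{p+1}`, then `w = αx + βy + λz` with `α, β ∈ 𝔪` and `λ` a unit, and the unit `u` with `u(w^p + h) = z^p + f` has
`uλ^p − 1 ∈ 𝔪`. NOT a statement of the manuscript. [folklore] -/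
theorem eq_lin_comb_of_span_eq (hR : IsRegularLocalRing R) (h3 : (maximalIdeal R).spanFinrank = 3) {x y z : R}
    (hxyz : Ideal.span {x, y, z} = maximalIdeal R) {w h f : R} (hw : w ∈ maximalIdeal R)
    (hh : h ∈ maximalIdeal R ^ (p + 1)) (hf : f ∈ maximalIdeal R ^ (p + 1)) {u : R} (hu : u * (w ^ p + h) = z ^ p + f) :
    ∃ α β lam : R, w = α * x + β * y + lam * z ∧ α ∈ maximalIdeal R ∧ β ∈ maximalIdeal R ∧ IsUnit lam ∧
      u * lam ^ p - 1 ∈ maximalIdeal R := by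
  have hp0 : p ≠ 0 := (Fact.out : p.Prime).ne_zero
  have hw' : w ∈ Ideal.span ({x, y, z} : Set R) := hxyz ▸ hw
  obtain ⟨α, r, hr, hweq⟩ := Ideal.mem_span_insert.mp hw'
  obtain ⟨β, lam, rfl⟩ := Ideal.mem_span_pair.mp hr
  refine ⟨α, β, lam, by rw [hweq]; ring, ?_⟩
  -- Frobenius
  have hfrob : w ^ p = (α * x) ^ p + (β * y) ^ p + (lam * z) ^ p := by
    rw [hweq, show α * x + (β * y + lam * z) = α * x + β * y + lam * z from by ring, add_add_pow_char p]
  -- the degree-`p` combination `uα^p x^p + uβ^p y^p + (uλ^p − 1) z^p = f − u h ∈ 𝔪^{p+1}`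
  have hcomb : (u * α ^ p) * x ^ p + (u * β ^ p) * y ^ p + (u * lam ^ p - 1) * z ^ p ∈ maximalIdeal R ^ (p + 1) := by
    have : (u * α ^ p) * x ^ p + (u * β ^ p) * y ^ p + (u * lam ^ p - 1) * z ^ p = f - u * h := by
      have h1 : u * w ^ p + u * h = z ^ p + f := by rw [← hu]; ring
      rw [hfrob, mul_pow, mul_pow, mul_pow] at h1
      linear_combination h1
    rw [this]
    exact Ideal.sub_mem _ hf (Ideal.mul_mem_left _ _ hh)
  obtain ⟨hα, hβ, hν⟩ := coeffs_mem_of_pow_combination_mem hR h3 hxyz hp0 hcomb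
  have hαm : α ∈ maximalIdeal R := by
    have : α ^ p ∈ maximalIdeal R := by
      by_contra hαp
      have hαu : IsUnit (α ^ p) := not_not.mp fun h' => hαp ((mem_maximalIdeal _).mpr (mem_nonunits_iff.mpr h'))
      have huu : ¬ IsUnit u → False := fun h' => by
        -- `u` is a unit: `uλ^p − 1 ∈ 𝔪`
        have : u * lam ^ p ∈ maximalIdeal R := Ideal.mul_mem_right _ _ ((mem_maximalIdeal _).mpr (mem_nonunits_iff.mpr h'))
        have h1 : (1 : R) ∈ maximalIdeal R := by
          have := Ideal.sub_mem _ this hν; rwa [sub_sub_cancel] at this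
        exact (maximalIdeal.isMaximal R).ne_top ((Ideal.eq_top_iff_one _).mpr h1)
      have hu' : IsUnit u := by by_contra h'; exact huu h'
      exact (maximalIdeal.isMaximal R).ne_top (Ideal.eq_top_of_isUnit_mem _ hα (hu'.mul hαu))
    exact (maximalIdeal.isMaximal R).isPrime.mem_of_pow_mem p this
  have hβm : β ∈ maximalIdeal R := by
    have : β ^ p ∈ maximalIdeal R := by
      by_contra hβp
      have hβu : IsUnit (β ^ p) := not_not.mp fun h' => hβp ((mem_maximalIdeal _).mpr (mem_nonunits_iff.mpr h'))
      have hu' : IsUnit u := by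
        by_contra h'
        have : u * lam ^ p ∈ maximalIdeal R := Ideal.mul_mem_right _ _ ((mem_maximalIdeal _).mpr (mem_nonunits_iff.mpr h'))
        have h1 : (1 : R) ∈ maximalIdeal R := by
          have := Ideal.sub_mem _ this hν; rwa [sub_sub_cancel] at this
        exact (maximalIdeal.isMaximal R).ne_top ((Ideal.eq_top_iff_one _).mpr h1)
      exact (maximalIdeal.isMaximal R).ne_top (Ideal.eq_top_of_isUnit_mem _ hβ (hu'.mul hβu))
    exact (maximalIdeal.isMaximal R).isPrime.mem_of_pow_mem p this
  have hlam : IsUnit lam := by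
    by_contra h'
    have : u * lam ^ p ∈ maximalIdeal R :=
      Ideal.mul_mem_left _ _ (Ideal.pow_mem_of_mem _ ((mem_maximalIdeal _).mpr (mem_nonunits_iff.mpr h')) p
        (Nat.pos_of_ne_zero hp0))
    have h1 : (1 : R) ∈ maximalIdeal R := by
      have := Ideal.sub_mem _ this hν; rwa [sub_sub_cancel] at this
    exact (maximalIdeal.isMaximal R).ne_top ((Ideal.eq_top_iff_one _).mpr h1)
  exact ⟨hαm, hβm, hlam, hν⟩

/-- **[OURS · L1 W4.6 rung (iii-2), heavy side] TRANSFER OF THE RESIDUE FORM.** Let `R` be a regular local ring of embedding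
dimension `3` and characteristic `p` with regular system of parameters `(x, y, z)`, `p < d < 2p`, and let
`(z^p + Σ_{k ≤ d} a_k x^{d−k} y^k) = (w^p + h)` as ideals, where `w ∈ 𝔪` and `h ≡ H(x, y, z) (mod 𝔪^{d+1})` for a form `H` of
degree `d` (the degree-`d` data of `h` IN THE PRESENTATION'S PARAMETERS). Then for some unit `u`: `a_k − u · [X^{d−k}Y^k] H ∈ 𝔪`
for every `k ≤ d` — the residue binary form `Σ ā_k X^{d−k} Y^k` of the presentation is `ū` times the `Z`-free part of `H̄`. This is
the tool that reads a chart computation of the transform in an arbitrary window presentation handed over by the regime. NOT a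
statement of the manuscript. [folklore] -/
theorem coeff_sub_mul_coeff_mem_of_span_eq (hR : IsRegularLocalRing R) (h3 : (maximalIdeal R).spanFinrank = 3) {x y z : R}
    (hxyz : Ideal.span {x, y, z} = maximalIdeal R) {d : ℕ} (hpd : p < d) (hd2 : d < 2 * p) (a : ℕ → R) {w h : R}
    (hw : w ∈ maximalIdeal R) {H : MvPolynomial (Fin 3) R} (hH : H.IsHomogeneous d)
    (hh : h - eval ![x, y, z] H ∈ maximalIdeal R ^ (d + 1))
    (heq : Ideal.span {w ^ p + h} = Ideal.span {z ^ p + ∑ k ∈ Finset.range (d + 1), a k * x ^ (d - k) * y ^ k}) :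
    ∃ u : R, IsUnit u ∧ ∀ k ≤ d, a k - u * H.coeff (Finsupp.single 0 (d - k) + Finsupp.single 1 k) ∈ maximalIdeal R := by
  classical
  haveI := hR
  haveI := isDomain_of_isRegularLocalRing R
  have hp1 : 1 ≤ p := (Fact.out : p.Prime).one_lt.le
  set f : R := ∑ k ∈ Finset.range (d + 1), a k * x ^ (d - k) * y ^ k with hfdef
  -- membership facts
  have hx : x ∈ maximalIdeal R := hxyz ▸ Ideal.subset_span (by simp)
  have hy : y ∈ maximalIdeal R := hxyz ▸ Ideal.subset_span (by simp)
  have hz : z ∈ maximalIdeal R := hxyz ▸ Ideal.subset_span (by simp)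
  have hHev : eval ![x, y, z] H ∈ maximalIdeal R ^ d := by
    have := eval_mem_span_pow (![x, y, z]) hH
    rwa [span_range_vec3 hxyz] at this
  have hhd : h ∈ maximalIdeal R ^ d := by
    have : h = (h - eval ![x, y, z] H) + eval ![x, y, z] H := by ring
    rw [this]
    exact Ideal.add_mem _ (Ideal.pow_le_pow_right (by omega) hh) hHev
  have hfd : f ∈ maximalIdeal R ^ d := by
    have hle : Ideal.span {x, y} ≤ maximalIdeal R := by
      rw [Ideal.span_le]; intro b hb; rcases hb with rfl | rfl <;> simpa
    exact Ideal.pow_right_mono hle d (coeffForm_mem_span_pow x y d a)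
  -- the unit
  obtain ⟨u, hu⟩ := Ideal.span_singleton_eq_span_singleton.mp heq
  have hu' : (↑u : R) * (w ^ p + h) = z ^ p + f := by rw [← hu]; ring
  obtain ⟨α, β, lam, hweq, hα, hβ, hlam, hν⟩ := eq_lin_comb_of_span_eq p hR h3 hxyz hw
    (Ideal.pow_le_pow_right (by omega) hhd) (Ideal.pow_le_pow_right (by omega) hfd) hu'
  set ν : R := ↑u * lam ^ p - 1 with hνdef
  -- the identity `f − u h − ν z^p = u (αx)^p + u (βy)^p`
  have hfrob : w ^ p = (α * x) ^ p + (β * y) ^ p + (lam * z) ^ p := by rw [hweq, add_add_pow_char p]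
  have hid : f - ↑u * h - ν * z ^ p = ↑u * (α * x) ^ p + ↑u * (β * y) ^ p := by
    have h1 : ↑u * w ^ p + ↑u * h = z ^ p + f := by rw [← hu']; ring
    rw [hfrob, mul_pow lam z] at h1
    rw [hνdef]
    linear_combination -h1
  -- the `p`-th powers of `αx`, `βy` are deep: in `𝔪^{2p} ⊆ 𝔪^{d+1}`
  have hdeep : ↑u * (α * x) ^ p + ↑u * (β * y) ^ p ∈ maximalIdeal R ^ (d + 1) := by
    have h2 : ∀ {c v : R}, c ∈ maximalIdeal R → v ∈ maximalIdeal R → (c * v) ^ p ∈ maximalIdeal R ^ (d + 1) := by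
      intro c v hc hv
      have : (c * v) ^ p ∈ maximalIdeal R ^ (2 * p) := by
        have hcv : c * v ∈ maximalIdeal R ^ 2 := by rw [pow_two]; exact Ideal.mul_mem_mul hc hv
        have := Ideal.pow_mem_pow hcv p
        rwa [← pow_mul] at this
      exact Ideal.pow_le_pow_right (by omega) this
    exact Ideal.add_mem _ (Ideal.mul_mem_left _ _ (h2 hα hx)) (Ideal.mul_mem_left _ _ (h2 hβ hy))
  -- push `ν z^p ∈ 𝔪^d` down: `ν ∈ 𝔪^{d−p}`
  have hνzp : ν * z ^ p ∈ maximalIdeal R ^ d := by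
    have : ν * z ^ p = f - ↑u * h - (↑u * (α * x) ^ p + ↑u * (β * y) ^ p) := by rw [← hid]; ring
    rw [this]
    exact Ideal.sub_mem _ (Ideal.sub_mem _ hfd (Ideal.mul_mem_left _ _ hhd)) (Ideal.pow_le_pow_right (by omega) hdeep)
  have hνpow : ∀ j ≤ d - p, ν ∈ maximalIdeal R ^ j := by
    intro j hj
    induction j with
    | zero => simp
    | succ j ih =>
      have hj' : ν ∈ maximalIdeal R ^ j := ih (by omega)
      exact mem_pow_succ_of_mul_pow_mem hR h3 hxyz hj' (Ideal.pow_le_pow_right (by omega) hνzp)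
  have hν' : ν ∈ Ideal.span (Set.range ![x, y, z]) ^ (d - p) := by
    rw [span_range_vec3 hxyz]; exact hνpow _ le_rfl
  obtain ⟨G, hG, hGν⟩ := exists_isHomogeneous_of_mem_span_pow (![x, y, z]) (d - p) hν'
  -- the degree-`d` form `Φ = F − u H − G Z^p`
  set Φ : MvPolynomial (Fin 3) R := (∑ k ∈ Finset.range (d + 1), monomial (Finsupp.single 0 (d - k) + Finsupp.single 1 k) (a k)) -
    C (↑u : R) * H - G * X 2 ^ p with hΦdef
  have hCH : (C (↑u : R) * H).IsHomogeneous d := hH.C_mul _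
  have hGZ : (G * X 2 ^ p).IsHomogeneous d := by
    have := hG.mul (isHomogeneous_X_pow (R := R) (2 : Fin 3) p)
    rwa [Nat.sub_add_cancel hpd.le] at this
  have hΦ : Φ.IsHomogeneous d := by
    rw [hΦdef]
    exact ((isHomogeneous_xyForm d a).sub hCH).sub hGZ
  have hΦev : eval ![x, y, z] Φ ∈ maximalIdeal R ^ (d + 1) := by
    have : eval ![x, y, z] Φ = (f - ↑u * h - ν * z ^ p) + ↑u * (h - eval ![x, y, z] H) := by
      rw [hΦdef, map_sub, map_sub, map_mul, map_mul, map_pow, eval_C, eval_X, eval_xyForm, hGν]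
      show f - ↑u * eval ![x, y, z] H - ν * z ^ p = _
      ring
    rw [this, hid]
    exact Ideal.add_mem _ hdeep (Ideal.mul_mem_left _ _ hh)
  have key := coeff_mem_of_eval_mem_pow_succ hR h3 hxyz hΦ hΦev
  refine ⟨↑u, Units.isUnit u, fun k hk => ?_⟩
  have hm : ¬ Finsupp.single (2 : Fin 3) p ≤ Finsupp.single 0 (d - k) + Finsupp.single 1 k := by
    intro hle
    have := hle 2
    simp only [Finsupp.single_eq_same, Finsupp.coe_add, Pi.add_apply] at this
    simp at this
    omega
  have := key (Finsupp.single 0 (d - k) + Finsupp.single 1 k)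
  rwa [hΦdef, coeff_sub, coeff_sub, coeff_C_mul, coeff_xyForm hk, coeff_mul_X_two_pow_of_not_le G p hm, sub_zero] at this

end Transfer

end Summit.ResolutionOfSingularities.ResolutionOfSingularities.Theorems.CampaignW46.MohWindowSurface

end
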